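import Literature.MathematicalPhysics.QuantumFieldTheory.Balaban1983to89.B8SockHFPRDSrcPer
import Literature.MathematicalPhysics.QuantumFieldTheory.Balaban1983to89.B8Prop5SocketDatumSrcGammaPrime

/-!
# [B8] Proposition 5 ASSEMBLED FOR THE PERIODIC LEVEL-`m` DATUM WITH A SOURCE (Theorem 8's (1.146)), EDITION γ′ — (1.35) in print's literal p. 77
# ONE-END-POINT class, the tower law at truncation `m`, and the sourced b9 class law «box ⊂ Ω_{j−1}» (print's (1.31) crossing bonds): the periodic twin of
# dag-n05-w4's `B8SockHFPRDSrcGammaPrime.sockHFP_body_of_join_RD_src_γ'`, i.e. lit-balaban r05's `B8SockHFPRDSrcPer.sockHFP_body_of_join_RD_src_per` (p664407)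
# with its ONE source-size call moved from `grad_bound_of_datum_src` to `grad_bound_of_datum_src_γ'` (B8-P5-NESTED-SERVER, existence instance (ii), layer E-ii-3′)

statement-level skeleton of published theorems with citation tags; proofs where landed; nothing here is a claim about the Yang–Mills mass gap

Bałaban, *Comm. Math. Phys.* **99** (1985) 75–102 ([B8] = `[Balaban1985RegularSpaces]`; PDF page = printed page − 74; PDF held:
`paper:balaban1985-cmp99-regular-spaces-gauge-fixing`): Prop. 5 (1.106)–(1.110) p. 94, Thm 4 p. 88 ∕ p. 95, Thm 8 (1.146) p. 101, (1.67)–(1.69) p. 88,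
(1.31) + (1.35) p. 82, (1.42) p. 83, (1.57)–(1.59) p. 86, p. 77 («Ω_j ⊂ T_η»), (1.5)–(1.6) p. 77, §3 p. 98; [3] = `[Balaban1985Averaging]` Prop. 4 p. 38;
[4] = `[Balaban1985BackgroundPropagators]` Thm 3.1 p. 397, (3.25) p. 394, Thm 3.3 p. 399.  STATUS: published, refereed.

CITATION HEADER (lean-in-tree rule).  Cell `lit-balaban` (mega-formalisation, Literature placement), seat `lit-balaban-p21` (g41), for pub-ymgap's IR
B8-P5-NESTED-SERVER (dag-n05-c, pub-ymgap INBOX l.41793; lit-balaban lead g33 18:12Z ∕ 18:26Z 2026-08-28), existence instance (ii) «Theorem-8 source» —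
r05 g96's E-ii stack (E-ii-1 p663593, E-ii-2 p664000, E-ii-3 p664407).  p21 g41's kernel FIT TEST of the staged server against the CONSUMER's binder texts
(pub-ymgap T6c `B8Thm8SurvivingZdGF3HP2PerMapLanEGammaGuarded`, p655863; T5 `B8Thm4CoreZdGF3HP2PerLanEGamma`) found the consumer's sourced b9 socket
`SH59src` stated over PRINT's class `towerBondsP L (ι a).Ω ((ι a).Λs m) ·` (T5 :164 ∕ :169; instantiated at the Λb-generic body by
`B8TowerBondsPrinted.ZdIdx.towerBondsP_laws`, whose box law reads «box ⊂ Ω_{j−1}»), while E-ii-3's storey asks the class law «box ⊂ Ω_j» — the letter of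
n05-d's edition-less `B8Prop5SocketDatumSrc.grad_bound_of_datum_src`.  dag-n05-w4 met the same fork on `ℤᵈ` («THE TWO γ-CURRENCIES OF (1.35)»,
`B8SockSP5UniformThresholdsSrcGammaPrime` header): the γ′ providers are separate twins whose source-size step is `B8Prop5SocketDatumSrcGammaPrime.grad_bound_of_datum_src_γ'`
— class law «box ⊂ Ω_{j−1}», (1.35) in the one-end-point form, the tower law at truncation `m` displayed, [3] Prop. 4's windows one level lower at `(L²α₀, L·α₂)`,
the L²-scaled (1.56) constant.  THIS FILE is that twin of r05's periodic storey.

WHAT THIS FILE PROVES (kernel, 0 sorry, one theorem, no `def`).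
★ `sockHFP_body_of_join_RD_src_γ'_per` = r05's `B8SockHFPRDSrcPer.sockHFP_body_of_join_RD_src_per` :97 with EXACTLY dag-n05-w4's γ′ binder delta
(`B8SockHFPRDSrc.sockHFP_body_of_join_RD_src` → `B8SockHFPRDSrcGammaPrime.sockHFP_body_of_join_RD_src_γ'`, token for token): `hbox` at `Ω (j - 1)`;
one more member law `htwm` (towers of `Λs m j` in `Ω_j` at the datum's truncation `m`); `h135` in the one-end-point form (= T5's (1.35) text); `hC₂` with the
factor `L²`; three more windows `hα3L hα4L hsmallL` at `(L²α₀, c_B)`; in the proof the five-line `(L²α₀, L·c⋆)` window block and the call of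
`grad_bound_of_datum_src_γ'` (with `htwm`).  Periodicity binders, the sourced b9 input `SH59m` (periodicity premiss included), the source `f`, the JOIN
(`B8Prop5JoinSectELocalRDSrcPer.hFP_kLevel_of_sectE_local'_RD_src_per`), the datum dictionary and the CONCLUSION are r05's VERBATIM.  The base storey
(`u₁ = 1`, no b9 input, no class) is r05's `B8SockHFPRDSrcPer.sockHFP₀_body_of_join_RD_src_per`, reused as is by the γ′ server layers (as w4 reused n05-d's).

HONEST SCOPE ∕ A6.  By-name re-assembly; 0 new estimates.  [4]'s letters and the sourced (1.59) lines over the PARAMETRIC class `Λb` are HYPOTHESES (N06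
content at `m ≥ 1`; the sourced b9 lines over a «box ⊂ Ω_j» class are known false at some nested members on `ℤᵈ` — dag-n05-c p572834 ∕ p576185, dag-n05-d
p585094 — which is WHY the consumer states them over print's class); no joint-satisfiability claim; Prop. 5, Sect. E, [4], [3] Prop. 4 NOT re-proved; windows
displayed, not discharged; `d ≥ 2`, `L ≥ 2`.  Count-neutral; N05 NOT discharged; `T_η` read as `P`-periodic data on `ηℤᵈ`; one finite `T⁴` programme at
fixed `ε` — nothing continuum ∕ ℝ⁴ ∕ OS ∕ mass-gap ∕ Clay: the Yang–Mills mass gap is NOT proved here or by anything this file feeds.  No `sorry`, no `def`,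
no `instance`, no `notation`.  RELATED IN THE TREE, NOT DUPLICATED: `B8SockHFPRDSrcPer` (r05; class law «box ⊂ Ω_j»; base storey USED downstream),
`B8SockHFPRDSrcGammaPrime` (dag-n05-w4; `ℤᵈ`), `B8SockP5uEBodyNestedSrcPer` (p21 g39; the uniqueness half's sourced periodic storey, same γ′ lemma).
-/

noncomputable section

open NormedSpace Metric Set Filter Topology
open Complex (I)
open scoped BigOperators

namespace Literature.MathematicalPhysics.QuantumFieldTheory.Balaban1983to89.B8SockHFPRDSrcGammaPrimePer

open B7Prop1Explicit B7Prop2Explicit B7Prop1Local B7Eq92Concrete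
open B7Prop2Explicit (C0 c2')
open B7Prop3Flat (c3)
open B7Prop10General (C6 C4G)
open B7Prop9Flat (C5')
open B7Eq78Linearization (conjR zdBlocking QprimeIter)
open B8Ineq132 (covDerivFwd covDeriv InAk)
open B8Eq119TwistedAxial (Restr129 InAx bgT)
open B8Eq184Proof (gaugeExp cfgExp)
open B8Eq182Proof (gAd)
open B8Eq188Proof (frakF3)
open B8Lemma1NonAbelian (mulCfg)
open B8Eq140Level (SideTouches sideTouches_mono)
open B8Eq146AExpansion (iEta expCfg)
open B8Ineq130 (tlo thi)
open B8Thm2LogB (blockTop)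
open B8Eq138LandauZd (IsLandau138W covDivB covLap QT)
open B8Ineq125Concrete (C2p)
open B8Eq1117Concrete (XSpace)
open B8Prop3GaugeFixedKLevel (expCfg_iEta_eq_cfgExp)
open B8Eq155JBound (expCfg_iEta_mem_unitaryUnits)
open B8LeafModelZd3 (SockB9P3)
open B8Prop5ContractionKLevel (Bd2 Mc Kc)
open B8LambdaSpaceKLevel (wt)
open B8Prop5Reality (isSelfAdjoint_covDeriv)
open B8Prop5SocketDatum (inAx_congr_of_towers exists_masked_datum grad_bound_of_datum grad_bound_trivial bd2_covDivB_of_grad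
  restr129_succ_of_truncation sideTouches_pair_of_mem sideTouches_of_tower_bond h33_of_inAk hP_of_datum h69_of_datum hA_of_datum)
open B8SockHFPAssembly (isSelfAdjoint_covDivB covDivB_congr_at frakF3_congr_at mgauge_one_eq inAx_mgauge_expCfg_of_datum)
open B8LeafModelZdOfHFP (SockHFP₀ SockHFP)
open B8LeafModelZdSockLetters (SockLetters)
open B8SockLettersRange (SockLettersR)
open B8SockLettersRD (SockLettersRD)
open B8SockHFPRange (sockLettersR_of_sockLetters)
open B8SockHFPWindows (hfpWindows_of_guard)
open QuantumLattice (blockSites)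
open B8Prop5SocketDatumSrcGammaPrime (grad_bound_of_datum_src_γ')
open B8Eq155JBound (Jcur wsup)
open B7Prop4GeneralLevels (linCovIter)
open B8ScaledSupNorm (bondNorm msup)
open B8Prop5JoinSectELocalRDSrcPer (hFP_kLevel_of_sectE_local'_RD_src_per)

-- `Site` alone could resolve to the torus sites of `Setup.lean`; re-export the `ℤ^d` sites of `B7Prop1Explicit`.
export B7Prop1Explicit (Site)

variable {d : ℕ}

section Bodies

variable {𝔸 : Type*} [CStarAlgebra 𝔸] [Nontrivial 𝔸]

/-- ★ **EDITION γ′ (print's box law «box ⊂ Ω_{j−1}» for the sourced b9 socket's class `Λb`; (1.35) in the p. 77 one-end-point form; the tower law at truncation `m` displayed (`htwm`); three added windows `hα3L hα4L hsmallL` at `(L²α₀, c_B)`; `C₂` L²-scaled; the source-size step by `B8Prop5SocketDatumSrcGammaPrime.grad_bound_of_datum_src_γ'` — dag-n05-w4's `B8SockHFPRDSrcGammaPrime` delta, token for token) OF r05's: **PROPOSITION 5 ASSEMBLED FOR THE PERIODIC LEVEL-`m` DATUM WITH A SOURCE, ON THE TORUS** — the ∃λ-storey of the periodic × sourced existence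
stack: t2s-1's `B8SockHFPTraceFreePer.sockHFP_body_of_join_RD_traceFree_per` with the J-SU trace functional and its group data DROPPED (`U₀` unitary, `u₁`
unitary — the `τ := 0`, `G := U(𝔸)`, `H := ⊤` instance, now definitionally) and dag-n05-d's source delta of `B8SockHFPRDSrc.sockHFP_body_of_join_RD_src`:
the Landau predicate at level `m` ABSTRACT (`Lan m U₁`), the b9 input SOURCED (`SH59m`: the two (1.59)-lines with source terms `Sa`, `Sg` for every masked
exponent that is PERIODIC — the periodicity premiss is what T5's `SH59src` socket carries; the storey feeds it its own `hA'per`), `|D*A′|₍₋₂₎ ≤ d·L²·(c⋆ + 2S_g) ≤ c_DA`, the source `f` at level `m + 1` (Hermitian, `Bd2`-size `m_f`, PERIODIC),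
(1.103)∕(1.106) at `+ m_f∕2`, the multiplier form WITH SOURCE; engine = `B8Prop5JoinSectELocalRDSrcPer.hFP_kLevel_of_sectE_local'_RD_src_per`.  Conclusion:
`λ` periodic, Hermitian, `= 0` off `Ω₀`, (1.108) window at `α₄ = 8B₀′c⋆` on the bonds of the plaquettes touching `Ω_j` (`j ≤ m + 1`), the multiplier form
«`Δ(𝟙_{Ω₀}(D*A + Δλ + 𝔑(λ) − f)) = Q′ᵀμ`», (1.29) for `u₁·e^{iλ}` at `m + 1` levels.
[cite: Balaban1985RegularSpaces, Prop. 5 (1.106)–(1.109) p.94, Thm 4 p.88 ∕ p.95, Thm 8 (1.146) p.101, (1.67)–(1.69) p.88, (1.31) + (1.35) p.82, (1.57)–(1.59) p.86, p.77, §3 p.98; Balaban1985BackgroundPropagators, Thm 3.1 p.397, Thm 3.3 p.399] -/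
theorem sockHFP_body_of_join_RD_src_γ'_per (hd2 : 2 ≤ d) {L : ℕ} (hL : 2 ≤ L) {η : ℝ} (hη : 0 < η)
    (P : ℤ) {k : ℕ}
    -- the member's geometry
    {Ω : ℕ → Set (Site d)} (hΩ : ∀ j, Ω (j + 1) ⊆ Ω j) {Λs : ℕ → ℕ → Set (Site d)} {Λb : ℕ → ℕ → Set (Site d × Fin d)}
    -- PRINT's box law: the locality box of a datum bond of level `j` lies in `Ω_{j−1}` ((1.31); level 0: `Ω₀`)
    (hbox : ∀ m, m ≤ k → ∀ j, j ≤ m → ∀ c ∈ Λb m j, ∀ x, InBox (loK L j c.1) (bondHiK L j c.1 c.2) x → x ∈ Ω (j - 1))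
    (hclass : ∀ m, m ≤ k → ∀ j, j ≤ m → ∀ c ∈ Λb m j,
      (c.1 ∈ Λs m j ∧ c.1 + e c.2 ∈ Λs m j) ∨
      (∃ j', j = j' + 1 ∧ (∀ x, (L : ℤ) • c.1 ≤ x → x ≤ (L : ℤ) • c.1 + blockTop L → x ∈ Λs m j') ∧ c.1 + e c.2 ∈ Λs m j) ∨
      (∃ j', j = j' + 1 ∧ c.1 ∈ Λs m j ∧ (∀ x, (L : ℤ) • (c.1 + e c.2) ≤ x → x ≤ (L : ℤ) • (c.1 + e c.2) + blockTop L → x ∈ Λs m j')))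
    {m : ℕ} (hm1 : 1 ≤ m) (hmk : m < k)
    (htower : ∀ j, j ≤ m + 1 → ∀ y ∈ Λs (m + 1) j, ∀ x, InBox (tlo L y j) (thi L y j) x → x ∈ Ω j)
    (hlt : ∀ j, j < m → Λs m j = Λs (m + 1) j)
    (htop : ∀ x, x ∈ Λs m m ↔ x ∈ Λs (m + 1) m ∨ ∃ y ∈ Λs (m + 1) (m + 1), x ∈ blockSites L y)
    -- EDITION γ′: the tower law AT THE DATUM's TRUNCATION `m` ((1.5)–(1.6) p. 77) — what `H42_of_inAx_γ'` asks
    (htwm : ∀ j, j ≤ m → ∀ y ∈ Λs m j, ∀ x, InBox (tlo L y j) (thi L y j) x → x ∈ Ω j)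
    -- the socket's antecedents: constants, (1.33), (1.34), (1.35)/(1.66)
    {α₀ α₁ B₀ B₀' cs α₄ : ℝ} (hα₀ : 0 < α₀) (hα₁ : 0 < α₁) (hB₀ : 0 < B₀) (hB₀' : 0 < B₀')
    (hcs : cs = 5 * (d : ℝ) * L * B₀ * (α₀ + α₁)) (hα₄ : α₄ = 8 * B₀' * (5 * (d : ℝ) * L * B₀) * (α₀ + α₁))
    {U₀ U' : Site d → Fin d → 𝔸ˣ} (hU₀ : ∀ x κ, U₀ x κ ∈ unitaryUnits 𝔸) (hU' : ∀ x κ, U' x κ ∈ unitaryUnits 𝔸)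
    (h33 : InAk L k η α₀ Ω U₀) (h34 : InAk L k η α₀ Ω (mulCfg U' U₀)) (hAx : ∀ m', m' ≤ k → InAx L m' (Λs m') U₀ (mulCfg U' U₀))
    (h135 : ∀ j, j ≤ k → ∀ (z : Site d) (μ : Fin d),
        ((∀ x, InBox (tlo L z j) (thi L z j) x → x ∈ Ω j) ∨ (∀ x, InBox (tlo L (z + e μ) j) (thi L (z + e μ) j) x → x ∈ Ω j)) →
      ‖(avgIter L (mulCfg U' U₀) j z μ : 𝔸) - (avgIter L U₀ j z μ : 𝔸)‖ ≤ α₁)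
    -- the datum at level `m`
    {u₁ : Site d → 𝔸ˣ} {U₁ : Site d → Fin d → 𝔸ˣ} {A : Site d → Fin d → 𝔸}
    (hu₁ : ∀ x, u₁ x ∈ unitaryUnits 𝔸) (hW : mgauge U₀ u₁ U₁ = U') (h129 : Restr129 L m (Λs m) U₀ u₁)
    (Lan : ℕ → (Site d → Fin d → 𝔸ˣ) → Prop) (hLan : Lan m U₁)
    (hdat : ∀ j, j ≤ m → ∀ b ∈ {b : Site d × Fin d | SideTouches (Ω j) b.1 b.2},
      U₁ b.1 b.2 = cfgExp η A b.1 b.2 ∧ IsSelfAdjoint (A b.1 b.2) ∧ ‖A b.1 b.2‖ ≤ cs * ((L : ℝ) ^ j * η)⁻¹)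
    -- THE SOURCED b9 INPUT AT THE DATUM ([4] Thm 3.3 + (1.57)–(1.58) for the sourced gauge condition at level `m`: the two (1.59)-lines WITH SOURCE
    -- TERMS `Sa`, `Sg` for every masked exponent of `U₁` — what the knit's `SH59src` delivers at `(m, u₁, U₁)`), and THE SOURCE `f` at level `m + 1` (PERIODIC)
    {Sa Sg : ℝ} (hSg : 0 ≤ Sg)
    (SH59m : ∀ A' : Site d → Fin d → 𝔸, (∀ (z : Site d) (i : Fin d), A' (z + P • e i) = A' z) → (∀ y τ, IsSelfAdjoint (A' y τ)) →
      (∀ j, j ≤ m → ∀ (y : Site d) (τ : Fin d), SideTouches (Ω j) y τ → U₁ y τ = cfgExp η A' y τ ∧ ‖A' y τ‖ ≤ cs * ((L : ℝ) ^ j * η)⁻¹) →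
      (∀ (y : Site d) (τ : Fin d), (∀ j, j ≤ m → ¬ SideTouches (Ω j) y τ) → A' y τ = 0) →
      msup L m η (-(1 : ℝ)) (fun j (b : Site d × Fin d) => SideTouches (Ω j) b.1 b.2) (fun b => A' b.1 b.2)
          ≤ B₀ * (bondNorm L m η (-(3 : ℝ)) Ω (fun x μ => Jcur η U₀ A' μ x)
          + wsup 1 (fun p : {p : ℕ × (Site d × Fin d) // p.1 ≤ m ∧ p.2 ∈ Λb m p.1} =>
          linCovIter L U₀ (iEta η A') p.1.1 p.1.2.1 p.1.2.2)) + Sa ∧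
        msup L m η (-(2 : ℝ)) (fun j (t : Fin d × Fin d × Site d) => SideTouches (Ω j) t.2.2 t.2.1)
          (fun t => covDerivFwd η U₀ t.1 (fun z => A' z t.2.1) t.2.2)
          ≤ B₀ * (bondNorm L m η (-(3 : ℝ)) Ω (fun x μ => Jcur η U₀ A' μ x)
          + wsup 1 (fun p : {p : ℕ × (Site d × Fin d) // p.1 ≤ m ∧ p.2 ∈ Λb m p.1} =>
          linCovIter L U₀ (iEta η A') p.1.1 p.1.2.1 p.1.2.2)) + Sg)
    {f : Site d → 𝔸} {mf : ℝ} (hmf : 0 ≤ mf) (hf : Bd2 L η (m + 1) Ω f mf) (hfsa : ∀ j, j ≤ m + 1 → ∀ x ∈ Ω j, IsSelfAdjoint (f x))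
    (hfper : ∀ (z : Site d) (i : Fin d), f (z + P • e i) = f z)
    -- Proposition 3's windows at `(α₀, α₂ := c⋆)` not implied by the JOIN's
    {C₂ : ℝ} (hside : 36 * d * B₀ * cs ≤ 1 / 2)
    (hC₂ : 8 * (131072 * ((d : ℝ) + 1) ^ 2) * Real.exp (4 * (800 * ((d : ℝ) + 1) ^ 2 * ((d : ℝ) + 4)) * ((L : ℝ) ^ 2 * α₀))
      * (L : ℝ) ^ 2 ≤ C₂)  -- EDITION γ: the L²-scaled (1.56) remainder constant
    (h61 : 2 * cs ^ 2 + 20 * d * α₀ * cs + 2 * C₂ * cs ^ 2 ≤ α₀ + α₁) (hsmall₁ : (d : ℝ) * L * α₁ ≤ 1 / 8)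
    -- the [4] LETTERS at `(m + 1, U₀)`, displayed as the JOIN reads them
    (g Δ : (Site d → 𝔸) →ₗ[ℂ] (Site d → 𝔸)) (q : (Site d → 𝔸) →ₗ[ℂ] (ℕ → Site d → 𝔸)) (qs : (ℕ → Site d → 𝔸) →ₗ[ℂ] (Site d → 𝔸))
    (Aw c : (ℕ → Site d → 𝔸) →ₗ[ℂ] (ℕ → Site d → 𝔸))
    (g_rightΩ : ∀ x, (∀ (z : Site d) (i : Fin d), x (z + P • e i) = x z) → ∀ y ∈ Ω 0, (Δ (g x) + qs (Aw (q (g x)))) y = x y)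
    (c_range : ∀ f, (∀ (z : Site d) (i : Fin d), f (z + P • e i) = f z) → q (g (g (qs (c (q f))))) = q f)
    -- the torus: every `Lʲ ∣ P`, shift-invariant `Λ_j` ∕ side-touching, periodic `U₀`, `A`, `u₁`; periodicity-preserving `G′`, `Q′ᵀCQ′`, `H′`
    (hdiv : ∀ j, j ≤ m + 1 → ((L : ℤ) ^ j ∣ P))
    (hΛ : ∀ j, j ≤ m + 1 → ∀ (y : Site d) (i : Fin d), y + (P / (L : ℤ) ^ j) • e i ∈ Λs (m + 1) j ↔ y ∈ Λs (m + 1) j)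
    (hΩper : ∀ j, j ≤ m → ∀ (x : Site d) (κ : Fin d) (i : Fin d), SideTouches (Ω j) (x + P • e i) κ ↔ SideTouches (Ω j) x κ)
    (hU₀per : ∀ (z : Site d) (i : Fin d), U₀ (z + P • e i) = U₀ z) (hAper : ∀ (z : Site d) (i : Fin d), A (z + P • e i) = A z)
    (hu₁per : ∀ (z : Site d) (i : Fin d), u₁ (z + P • e i) = u₁ z)
    (hGper : ∀ (f : Site d → 𝔸) (z : Site d) (i : Fin d), g f (z + P • e i) = g f z)
    (hqcq_per : ∀ f : Site d → 𝔸, (∀ (z : Site d) (i : Fin d), f (z + P • e i) = f z) →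
      ∀ (z : Site d) (i : Fin d), qs (c (q f)) (z + P • e i) = qs (c (q f)) z)
    (hΔ : ∀ (f : Site d → 𝔸), ∀ x ∈ Ω 0, Δ f x = covLap η U₀ ((Ω 0).indicator f) x)
    (hqs : ∀ (μ : ℕ → Site d → 𝔸), ∀ x ∈ Ω 0, qs μ x = QT L (m + 1) (Λs (m + 1)) U₀ μ x)
    (hq : ∀ (f : Site d → 𝔸) (j : ℕ), j ≤ m + 1 → ∀ y ∈ Λs (m + 1) j, q f j y = QprimeIter (zdBlocking d L) (bgT L U₀) j f y)
    (H' : XSpace d (m + 1) 𝔸 →ₗ[ℂ] (Site d → 𝔸)) {B₀'H B₂' BG BR : ℝ} (hB₀'H : 0 < B₀'H) (hB₂' : 0 ≤ B₂') (hBG : 0 ≤ BG) (hBR : 0 ≤ BR)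
    (hH0 : ∀ (X : XSpace d (m + 1) 𝔸) (x : Site d), ‖H' X x‖ ≤ B₀'H * ‖X‖)
    (hH1 : ∀ j, j ≤ m + 1 → ∀ (X : XSpace d (m + 1) 𝔸), ∀ p ∈ {b : Site d × Fin d | SideTouches (Ω j) b.1 b.2},
      wt L η j * ‖covDerivFwd η U₀ p.2 (H' X) p.1‖ ≤ B₀'H * ‖X‖)
    (hH2 : ∀ X : XSpace d (m + 1) 𝔸, Bd2 L η (m + 1) Ω (covLap η U₀ (H' X)) (B₂' * ‖X‖))
    (hHsupp : ∀ (X : XSpace d (m + 1) 𝔸) (x : Site d), x ∉ Ω 0 → H' X x = 0)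
    (hHequiv : ∀ X Y : XSpace d (m + 1) 𝔸, (∀ p, Y p = -star (X p)) → ∀ x, H' Y x = -star (H' X x))
    (hHper : ∀ X : XSpace d (m + 1) 𝔸, (∀ (p : Fin (m + 1 + 1) × Site d) (i : Fin d), X (p.1, p.2 + (P / (L : ℤ) ^ (p.1 : ℕ)) • e i) = X p) →
      ∀ (z : Site d) (i : Fin d), H' X (z + P • e i) = H' X z)
    (hQH : ∀ (Y : XSpace d (m + 1) 𝔸), (∀ (p : Fin (m + 1 + 1) × Site d) (i : Fin d), Y (p.1, p.2 + (P / (L : ℤ) ^ (p.1 : ℕ)) • e i) = Y p) →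
      ∀ (j : ℕ) (hj : j ≤ m + 1) (y : Site d), y ∈ Λs (m + 1) j →
      QprimeIter (zdBlocking d L) (bgT L U₀) j (H' Y) y = Y (⟨j, Nat.lt_succ_of_le hj⟩, y))
    (hG : ∀ (f : Site d → 𝔸) (r : ℝ), 0 ≤ r → Bd2 L η (m + 1) Ω f r →
      (∀ x, ‖g f x‖ ≤ BG * r) ∧ ∀ j, j ≤ m + 1 → ∀ p ∈ {b : Site d × Fin d | SideTouches (Ω j) b.1 b.2},
        wt L η j * ‖covDerivFwd η U₀ p.2 (g f) p.1‖ ≤ BG * r)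
    (hGsupp : ∀ (f : Site d → 𝔸) (x : Site d), x ∉ Ω 0 → g f x = 0)
    (hGreal : ∀ f : Site d → 𝔸, (∀ j, j ≤ m + 1 → ∀ x ∈ Ω j, IsSelfAdjoint (f x)) → ∀ x, IsSelfAdjoint (g f x))
    (hRbd : ∀ (f : Site d → 𝔸) (r : ℝ), 0 ≤ r → Bd2 L η (m + 1) Ω f r → Bd2 L η (m + 1) Ω (f - g (qs (c (q (g f))))) (BR * r))
    (hRreal : ∀ f : Site d → 𝔸, (∀ j, j ≤ m + 1 → ∀ x ∈ Ω j, IsSelfAdjoint (f x)) →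
      ∀ j, j ≤ m + 1 → ∀ x ∈ Ω j, IsSelfAdjoint ((f - g (qs (c (q (g f))))) x))
    -- the JOIN's scalar windows, one-for-one (`αP := α₀`, `α₄ := 8B₀′c⋆`; `cB cA cDA` free above their datum values)
    {cB cA cDA : ℝ} (hcBlo : L * cs ≤ cB) (hcAlo : L * cs ≤ cA) (hcDAlo : (d : ℝ) * (L : ℝ) ^ 2 * (cs + 2 * Sg) ≤ cDA)
    (hα3 : C0 d * α₀ ≤ 1 / 3) (hα4 : 4 * α₀ ≤ c2' d L)
    (hsmall : Real.exp (4 * (800 * ((d : ℝ) + 1) ^ 2 * ((d : ℝ) + 4)) * α₀) * (1 + 8 * (131072 * ((d : ℝ) + 1) ^ 2) * cB) ≤ 2)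
    (hc₃ : 2 * cB ≤ c3 d L) (hsc : 2048 * (d : ℝ) * cB ≤ 1) (hα₃' : 40 * d * cB ≤ 1 / 200)
    (hs₁ : 200 * C6 d * (2 * α₄) ≤ 1) (hs₂ : 12000 * ((d : ℝ) + 1) * L * (2 * α₄) ≤ 1)
    (hs₃ : C4G d L * (α₀ + 40 * d * cB + 4 * (2 * α₄)) ≤ 1)
    (hs₄ : 1024 * ((d : ℝ) + 1) * ((d : ℝ) + 4) * L ^ 2 * α₀ ≤ 1) (hs₅ : 32 * ((d : ℝ) + 1) ^ 2 * C6 d * L ^ 2 * α₀ ≤ 1)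
    (hs₆ : 16 * d * C5' d * C6 d * (L : ℝ) ^ 2 * α₀ ≤ 1) (hs₇ : 8 * d * C6 d * L * α₀ ≤ 1)
    (hsm : 40 * d * cB + α₄ ≤ 1 / (4 * B₀'H * (2 * C2p d))) (hprod8 : 2 * C6 d * (40 * d * cB + 4 * α₄) ≤ 1 / 8)
    {hE hE₂ lE lE₂ : ℝ} (hE_def : hE = B₀'H * (C2p d * (40 * d * cB + α₄) * α₄)) (hE₂_def : hE₂ = B₂' * (C2p d * (40 * d * cB + α₄) * α₄))
    (lE_def : lE = B₀'H * (4 * C2p d * (40 * d * cB + 2 * α₄))) (lE₂_def : lE₂ = B₂' * (4 * C2p d * (40 * d * cB + 2 * α₄)))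
    (hcA' : cA ≤ 1 / 13) (ha₁' : α₄ / 4 + hE ≤ 1 / 24) (hb₁' : α₄ / 4 + hE ≤ 1 / 140) (hθ : 10 * (α₄ / 4 + hE) * BR ≤ 1 / 2)
    -- EDITION γ: [3] Prop. 4's windows of the (1.42)∕(1.56) steps ONE LEVEL LOWER, at `(L²α₀, c_B)` (`c_B ≥ L·c⋆`)
    (hα3L : C0 d * ((L : ℝ) ^ 2 * α₀) ≤ 1 / 3) (hα4L : 4 * ((L : ℝ) ^ 2 * α₀) ≤ c2' d L)
    (hsmallL : Real.exp (4 * (800 * ((d : ℝ) + 1) ^ 2 * ((d : ℝ) + 4)) * ((L : ℝ) ^ 2 * α₀)) * (1 + 8 * (131072 * ((d : ℝ) + 1) ^ 2) * cB) ≤ 2)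
    (h103 : BG * Mc d BR (α₄ / 4 + hE) cA (hE₂ + mf / 2) cDA ≤ α₄ / 4)
    (h106 : BG * Kc d BR (α₄ / 4 + hE) cA (hE₂ + mf / 2) cDA lE₂ (1 + lE) (1 + lE) ≤ 1 / 2) :
    ∃ lam : Site d → 𝔸, (∀ (z : Site d) (i : Fin d), lam (z + P • e i) = lam z) ∧
      (∀ x, IsSelfAdjoint (lam x)) ∧ (∀ x, x ∉ Ω 0 → lam x = 0) ∧
      (∀ j, j ≤ m + 1 → ∀ b ∈ {b : Site d × Fin d | SideTouches (Ω j) b.1 b.2},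
        ‖lam b.1‖ ≤ α₄ ∧ ((L : ℝ) ^ j * η) * ‖covDerivFwd η U₀ b.2 lam b.1‖ ≤ α₄) ∧
      (∃ μ : ℕ → Site d → 𝔸, ∀ x ∈ Ω 0,
        covLap η U₀ ((Ω 0).indicator fun y => covDivB η U₀ A y + covLap η U₀ lam y +
          ((conjR (gaugeExp lam y)⁻¹ (covDivB η U₀ A y) - covDivB η U₀ A y) +
            (gAd (covLap η U₀ lam y) (lam y) - covLap η U₀ lam y) + ∑ μ, frakF3 η U₀ lam A y μ) - f y) x =
          QT L (m + 1) (Λs (m + 1)) U₀ μ x) ∧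
      Restr129 L (m + 1) (Λs (m + 1)) U₀ (u₁ * gaugeExp lam) := by
  subst hcs
  have hL1 : 1 ≤ L := le_trans (by norm_num) hL
  have hd1 : 1 ≤ d := le_trans (by norm_num) hd2
  have hLr : (1 : ℝ) ≤ L := by exact_mod_cast hL1
  have hmK : m + 1 ≤ k := hmk
  have hsum : 0 < α₀ + α₁ := add_pos hα₀ hα₁
  have hcs0 : 0 ≤ 5 * (d : ℝ) * L * B₀ * (α₀ + α₁) := by positivity
  have hcspos : 0 < 5 * (d : ℝ) * L * B₀ * (α₀ + α₁) := by positivity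
  have hα₄pos : 0 < α₄ := by rw [hα₄]; positivity
  -- `c⋆ ≤ L·c⋆ ≤ cB`, hence Prop. 3's remaining windows from the JOIN's
  have hcsB : 5 * (d : ℝ) * L * B₀ * (α₀ + α₁) ≤ cB := (le_mul_of_one_le_left hcs0 hLr).trans hcBlo
  have hcB0 : 0 ≤ cB := hcs0.trans hcsB
  have hcA0 : 0 ≤ cA := (hcs0.trans (le_mul_of_one_le_left hcs0 hLr)).trans hcAlo
  have hcDA0 : 0 ≤ cDA := le_trans (by positivity) hcDAlo
  have hd0 : (1 : ℝ) ≤ d := by exact_mod_cast hd1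
  have hcBsmall : (d : ℝ) * cB ≤ 1 / 8000 := by linarith only [hα₃']
  have hdcs : (d : ℝ) * (5 * (d : ℝ) * L * B₀ * (α₀ + α₁)) ≤ 1 / 8000 :=
    (mul_le_mul_of_nonneg_left hcsB (by positivity)).trans hcBsmall
  have hcs8000 : 5 * (d : ℝ) * L * B₀ * (α₀ + α₁) ≤ 1 / 8000 := (le_mul_of_one_le_left hcs0 hd0).trans hdcs
  have h16 : 16 * (5 * (d : ℝ) * L * B₀ * (α₀ + α₁)) ≤ 1 := by linarith only [hcs8000]
  have h50 : 50 * d * (5 * (d : ℝ) * L * B₀ * (α₀ + α₁)) ≤ 1 := by linarith only [hdcs]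
  have hd5 : 5 * (5 * (d : ℝ) * L * B₀ * (α₀ + α₁)) * ((d : ℝ) - 1) ≤ 4 := by nlinarith only [hdcs, hcs0]
  have hc₃3 : 2 * (5 * (d : ℝ) * L * B₀ * (α₀ + α₁)) ≤ c3 d L := by linarith only [hc₃, hcsB]
  have hsmall3 : Real.exp (4 * (800 * ((d : ℝ) + 1) ^ 2 * ((d : ℝ) + 4)) * α₀) *
      (1 + 8 * (131072 * ((d : ℝ) + 1) ^ 2) * (5 * (d : ℝ) * L * B₀ * (α₀ + α₁))) ≤ 2 := by
    refine le_trans (mul_le_mul_of_nonneg_left ?_ (Real.exp_pos _).le) hsmall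
    have h := mul_le_mul_of_nonneg_left hcsB (show (0 : ℝ) ≤ 8 * (131072 * ((d : ℝ) + 1) ^ 2) by positivity)
    linarith only [h]
  have hαP2 : 2 * α₀ ≤ c2' d L := by linarith only [hα4, hα₀]
  -- EDITION γ: the (1.42)∕(1.56) windows at `(L²α₀, L·c⋆)` from `L·c⋆ ≤ c_B`
  have hLcs : (L : ℝ) * (5 * (d : ℝ) * L * B₀ * (α₀ + α₁)) ≤ cB := hcBlo
  have hcB1 : cB ≤ (d : ℝ) * cB := le_mul_of_one_le_left hcB0 hd0
  have h16L : 16 * ((L : ℝ) * (5 * (d : ℝ) * L * B₀ * (α₀ + α₁))) ≤ 1 := by linarith only [hLcs, hcBsmall, hcB1]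
  have hc₃3L : 2 * ((L : ℝ) * (5 * (d : ℝ) * L * B₀ * (α₀ + α₁))) ≤ c3 d L := by linarith only [hc₃, hLcs]
  have hsmall3L : Real.exp (4 * (800 * ((d : ℝ) + 1) ^ 2 * ((d : ℝ) + 4)) * ((L : ℝ) ^ 2 * α₀)) *
      (1 + 8 * (131072 * ((d : ℝ) + 1) ^ 2) * ((L : ℝ) * (5 * (d : ℝ) * L * B₀ * (α₀ + α₁)))) ≤ 2 := by
    refine le_trans (mul_le_mul_of_nonneg_left ?_ (Real.exp_pos _).le) hsmallL
    have h := mul_le_mul_of_nonneg_left hLcs (show (0 : ℝ) ≤ 8 * (131072 * ((d : ℝ) + 1) ^ 2) by positivity)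
    linarith only [h]
  -- the MASKED exponent `A′` of the datum (globally Hermitian, `= A` on the touched bonds)
  obtain ⟨A', hsa, hagree, hWA, hA0⟩ := exists_masked_datum hdat
  -- on the torus: the masked exponent is periodic (the touching predicates are shift-invariant)
  have hA'per : ∀ (z : Site d) (i : Fin d), A' (z + P • e i) = A' z := by
    intro z i
    funext κ
    by_cases h : ∃ j, j ≤ m ∧ SideTouches (Ω j) z κ
    · obtain ⟨j, hj, hs⟩ := h
      rw [hagree j hj z κ hs, hagree j hj (z + P • e i) κ ((hΩper j hj z κ i).2 hs), hAper z i]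
    · have h' : ∀ j, j ≤ m → ¬ SideTouches (Ω j) (z + P • e i) κ := fun j hj hs => h ⟨j, hj, (hΩper j hj z κ i).1 hs⟩
      rw [hA0 z κ (fun j hj hs => h ⟨j, hj, hs⟩), hA0 (z + P • e i) κ h']
  have hWA1 : ∀ j, j ≤ m → ∀ (y : Site d) (τ : Fin d), SideTouches (Ω j) y τ → U₁ y τ = cfgExp η A' y τ :=
    fun j hj y τ hs => (hWA j hj y τ hs).1
  have h41 : ∀ j, j ≤ m → ∀ (y : Site d) (τ : Fin d), SideTouches (Ω j) y τ →
      ‖A' y τ‖ ≤ (5 * (d : ℝ) * L * B₀ * (α₀ + α₁)) * ((L : ℝ) ^ j * η)⁻¹ := fun j hj y τ hs => (hWA j hj y τ hs).2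
  -- the JOIN's datum binders BY NAME (`B8Prop5SocketDatum` §7, §1, §5)
  have h33' := h33_of_inAk hL1 hα₀ h33 hmK htower
  have hP' := hP_of_datum hL1 hα₀ hΩ h34 hmK htower hu₁ hW hWA1
  have h69' : ∀ j, j ≤ m + 1 → ∀ y ∈ Λs (m + 1) j, ∀ (x : Site d) (κ : Fin d), InBox (tlo L y j) (thi L y j) x →
      InBox (tlo L y j) (thi L y j) (x + e κ) → ‖iEta η A' x κ‖ ≤ cB * ((L : ℝ) ^ j)⁻¹ :=
    fun j hj y hy x κ hx hxe =>
      (h69_of_datum hd2 hL1 hη hΩ htower hcs0 h41 j hj y hy x κ hx hxe).trans (mul_le_mul_of_nonneg_right hcBlo (by positivity))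
  have hA' : ∀ j, j ≤ m + 1 → ∀ x ∈ Ω j, ∀ μ : Fin d,
      wt L η j * ‖A' x μ‖ ≤ cA ∧ wt L η j * ‖conjR (U₀ (x - e μ) μ)⁻¹ (A' (x - e μ) μ)‖ ≤ cA := fun j hj x hx μ =>
    ⟨(hA_of_datum hd2 hL1 hη hΩ hU₀ hcs0 h41 j hj x hx μ).1.trans hcAlo, (hA_of_datum hd2 hL1 hη hΩ hU₀ hcs0 h41 j hj x hx μ).2.trans hcAlo⟩
  have hBu : ∀ (x : Site d) (κ : Fin d), expCfg (iEta η A') x κ ∈ unitaryUnits 𝔸 := expCfg_iEta_mem_unitaryUnits η hsa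
  have hAx' : InAx L (m + 1) (Λs (m + 1)) U₀ (mgauge U₀ u₁ (expCfg (iEta η A')) * U₀) :=
    inAx_mgauge_expCfg_of_datum hd2 hL1 hΩ htower hW hWA1 (hAx (m + 1) hmK)
  have h129' : Restr129 L (m + 1) (Λs (m + 1)) U₀ u₁ := restr129_succ_of_truncation hL1 hlt htop h129
  -- the source `D*A′`: (1.69)'s gradient member by Prop. 3 at level `m` (§3), then `|D*A′|₍₋₂₎ ≤ d·L²·c⋆ ≤ cDA` (§4); Hermitian
  obtain ⟨h59a, h59g⟩ := SH59m A' hA'per hsa hWA hA0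
  have hgrad := grad_bound_of_datum_src_γ' hd2 hη hL k hU₀ hU' hα₀ hα₁ hcspos hB₀.le hα3L hα4L h16L hd5 hsmall3L hc₃3L hside h50 hC₂ h61
    hsmall₁ Ω hΩ Λs Λb hbox hclass h33 h34 hAx h135 hm1 hmk.le htwm Lan hu₁ hW h129 hLan hsa hWA hA0 h59a h59g
  have hcsS : 0 ≤ 5 * (d : ℝ) * L * B₀ * (α₀ + α₁) + 2 * Sg := by positivity
  have hDA : Bd2 L η (m + 1) Ω (fun y => covDivB η U₀ A' y) cDA := fun j hj x hx =>
    (bd2_covDivB_of_grad hd2 hL1 hη hΩ hU₀ hcsS hgrad j hj x hx).trans hcDAlo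
  have hDAsa : ∀ j, j ≤ m + 1 → ∀ x ∈ Ω j, IsSelfAdjoint (covDivB η U₀ A' x) := fun j _ x _ => isSelfAdjoint_covDivB hU₀ hsa x
  -- the JOIN's bond classes `Eb j := {b ∣ SideTouches (Ω j) b}` (§6)
  have hEbΩ : ∀ j, j ≤ m + 1 → ∀ x ∈ Ω j, ∀ μ : Fin d, (x, μ) ∈ {b : Site d × Fin d | SideTouches (Ω j) b.1 b.2} ∧
      (x - e μ, μ) ∈ {b : Site d × Fin d | SideTouches (Ω j) b.1 b.2} := fun j _ x hx μ => sideTouches_pair_of_mem hd2 hx μ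
  have hEbT : ∀ j, j ≤ m + 1 → ∀ y ∈ Λs (m + 1) j, ∀ (x : Site d) (κ : Fin d), InBox (tlo L y j) (thi L y j) x →
      InBox (tlo L y j) (thi L y j) (x + e κ) → (x, κ) ∈ {b : Site d × Fin d | SideTouches (Ω j) b.1 b.2} :=
    fun j hj y hy x κ hx _ => sideTouches_of_tower_bond hd2 htower hj hy x κ hx
  -- THE JOIN WITH THE LAWS ON PRINT'S DOMAINS (`hFP_kLevel_of_sectE_local'_RD`, BY NAME) at `k := m + 1`, `Λs := Λs (m+1)`, `B := iηA′`, `αP := α₀`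
  obtain ⟨lam, hlper, hlsa, hloff, h108, ⟨μ, hmul⟩, h129''⟩ := hFP_kLevel_of_sectE_local'_RD_src_per
    (k := m + 1) (Λs := Λs (m + 1)) (Eb := fun j => {b : Site d × Fin d | SideTouches (Ω j) b.1 b.2}) (u₁ := u₁) (A := A') (f := f) hL hη hU₀ P hEbΩ
    hEbT g Δ q qs Aw c g_rightΩ c_range hdiv hΛ hU₀per hA'per hu₁per hGper hqcq_per hΔ hqs hq H' hα₀ hα3 hα4 hcB0 hα₄pos hB₀'H hB₂' h33'
    h69' hd1 hα₀ hα3 hαP2 hBu hP' hAx' h129' hH0 hH1 hH2 hHsupp hHequiv hHper hQH hsmall hc₃ hsc hα₃' hs₁ hs₂ hs₃ hs₄ hs₅ hs₆ hs₇ hsm hprod8 hE_def hE₂_def lE_def lE₂_def hBG hBR hcA0 hcA' hcDA0 ha₁' hb₁'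
    hθ hG hGsupp hGreal hRbd hRreal hDA hDAsa hA' hsa hmf hf hfsa hfper h103 h106
  refine ⟨lam, hlper, hlsa, hloff, fun j hj b hb => h108 j hj b hb, ⟨μ, fun x hx => ?_⟩, h129''⟩
  -- transport the multiplier clause from `A′` back to `A`: the two agree on the bonds read on `Ω₀`
  have hind : ((Ω 0).indicator fun y => covDivB η U₀ A y + covLap η U₀ lam y +
        ((conjR (gaugeExp lam y)⁻¹ (covDivB η U₀ A y) - covDivB η U₀ A y) +
          (gAd (covLap η U₀ lam y) (lam y) - covLap η U₀ lam y) + ∑ μ, frakF3 η U₀ lam A y μ) - f y) =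
      ((Ω 0).indicator fun y => covDivB η U₀ A' y + covLap η U₀ lam y +
        ((conjR (gaugeExp lam y)⁻¹ (covDivB η U₀ A' y) - covDivB η U₀ A' y) +
          (gAd (covLap η U₀ lam y) (lam y) - covLap η U₀ lam y) + ∑ μ, frakF3 η U₀ lam A' y μ) - f y) := by
    refine Set.indicator_congr fun y hy => ?_
    have h₁ : ∀ ν : Fin d, A' y ν = A y ν := fun ν => hagree 0 (Nat.zero_le _) y ν (sideTouches_pair_of_mem hd2 hy ν).1
    have h₂ : ∀ ν : Fin d, A' (y - e ν) ν = A (y - e ν) ν := fun ν => hagree 0 (Nat.zero_le _) (y - e ν) ν (sideTouches_pair_of_mem hd2 hy ν).2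
    have h₃ : ∀ ν : Fin d, frakF3 η U₀ lam A' y ν = frakF3 η U₀ lam A y ν := fun ν => frakF3_congr_at η U₀ lam (h₁ ν) (h₂ ν)
    simp only [covDivB_congr_at η U₀ h₁ h₂, h₃]
  rw [hind]
  exact hmul x hx

end Bodies

#print axioms sockHFP_body_of_join_RD_src_γ'_per

end Literature.MathematicalPhysics.QuantumFieldTheory.Balaban1983to89.B8SockHFPRDSrcGammaPrimePer

end
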